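import Summits.CriticalPhenomena.PercolationContinuityZ3.Theorems.SahiMasterFamily

/-!
# The complement expansion of Sahi's functional (all orders): `E_k(1 − a) = Σ_{|S| ≥ 2} (−1)^{|S|} ((k−2)!/(|S|−2)!) · E_{|S|}(a_S)`

Support file of the master-family programme (crux `NoHeavyLowerTail`, stmt-CriticalPhenomena-4575; cell `prim-masterthm`, seat P4,
unit `prim-masterthm-p4-g5`).  Seat document HOME/prim-masterthm-p4/CORNERS.md §1 (step (a) of the DENSE-END theorem D: near
`p → 1` the functional of increasing events `U_i` is expressed through the functionals of the rare failure events `1 − 1_{U_i}`).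

Pure algebra of Sahi's functional `E_n` (tree `Literature.Combinatorics.Sahi2008.sahiE`), any finite type, any weight:
* `sahiE_mix_eq_sum_powerset` — the MULTILINEAR EXPANSION over subsets of slots: `E_n(f + c·g on T, f elsewhere) =
  Σ_{S ⊆ T} (∏_{j∈S} c_j) · E_n(g on S, f elsewhere)`;
* `sahiE_one_sub_eq_sum_padded` — `E_n(1 − a) = Σ_{S} (−1)^{|S|} E_n(a on S, 1 elsewhere)`;
* `sahiE_eq_mul_of_slot_one` — Sahi's BRANCHING rule at an arbitrary slot (probability weight): a slot carrying the constant `1`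
  can be deleted at the price of the factor `n − 2` (from the tree's `sahiE_peel`);
* **`sahiE_padded_eq`** — iterated: a family equal to `1` off a set `S` of `s ≥ 1` slots has
  `E_n = (∏_{u < n−s} (s − 1 + u)) · E_s(restriction to S)` (restriction along `S.orderEmbOfFin`), i.e. `(n−2)!/(s−2)!` for
  `s ≥ 2` and `0` for `s = 1 < n`;
* **`sahiE_one_sub_eq_sum`** — THE COMPLEMENT EXPANSION: for a probability weight and `n ≥ 2`,
  `E_n(1 − a_0, …, 1 − a_{n−1}) = Σ_{S ⊆ [n], |S| ≥ 1} (−1)^{|S|} (∏_{u<n−|S|} (|S| − 1 + u)) · E_{|S|}(a_S)`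
  (the `|S| = 1` terms vanish, the empty term is `E_n(1,…,1) = 0`).  E.g. `E_3(1−a,1−b,1−c) = Σ Cov − E_3(a,b,c)`.
[this work; the branching rule is Sahi 2008 Thm. 6 / tree `sahiE_one_cons`]
-/

namespace Summit.CriticalPhenomena.PercolationContinuityZ3.Theorems

namespace SahiComplement

open Finset Function
open Literature.Combinatorics.Sahi2008

variable {α : Type*} [Fintype α]

/-! ### Multilinear expansion over subsets of slots -/

/-- The mixed family: `g` on `S`, `f` elsewhere. [this work] -/
def mixFam {n : ℕ} (f g : Fin n → α → ℝ) (S : Finset (Fin n)) : Fin n → α → ℝ := fun j => if j ∈ S then g j else f j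

omit [Fintype α] in
/-- `mixFam f g ∅ = f`. [this work] -/
theorem mixFam_empty {n : ℕ} (f g : Fin n → α → ℝ) : mixFam f g ∅ = f := by
  funext j; simp [mixFam]

omit [Fintype α] in
/-- Inserting a slot into `S` = switching that slot of the base family to `g`. [this work] -/
theorem mixFam_insert {n : ℕ} (f g : Fin n → α → ℝ) {S : Finset (Fin n)} {i : Fin n} (hi : i ∉ S) :
    mixFam f g (insert i S) = mixFam (update f i (g i)) g S := by
  funext j
  by_cases hji : j = i
  · subst hji; simp [mixFam, hi]
  · simp [mixFam, hji]

/-- **Multilinear expansion over subsets**: `E_n(f + c·g on T, f elsewhere) = Σ_{S ⊆ T} (∏_{j∈S} c_j) E_n(g on S, f elsewhere)`.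
[this work] -/
theorem sahiE_mix_eq_sum_powerset (μ : α → ℝ) {n : ℕ} (g : Fin n → α → ℝ) (c : Fin n → ℝ) (T : Finset (Fin n)) :
    ∀ f : Fin n → α → ℝ, sahiE μ n (fun j => if j ∈ T then f j + c j • g j else f j) =
      ∑ S ∈ T.powerset, (∏ j ∈ S, c j) * sahiE μ n (mixFam f g S) := by
  induction T using Finset.induction_on with
  | empty =>
    intro f
    simp only [notMem_empty, if_false, powerset_empty, sum_singleton, prod_empty, one_mul, mixFam_empty]
  | insert i T hi ih =>
    intro f
    set F₀ : Fin n → α → ℝ := fun j => if j ∈ T then f j + c j • g j else f j with hF₀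
    have hF : (fun j => if j ∈ insert i T then f j + c j • g j else f j) = update F₀ i (f i + c i • g i) := by
      funext j
      by_cases hji : j = i
      · subst hji; simp [hF₀, hi]
      · simp [hF₀, hji]
    have h1 : update F₀ i (f i) = F₀ := by
      have : F₀ i = f i := by simp [hF₀, hi]
      rw [← this, update_eq_self]
    have h2 : update F₀ i (g i) = fun j => if j ∈ T then update f i (g i) j + c j • g j else update f i (g i) j := by
      funext j
      by_cases hji : j = i
      · subst hji; simp [hF₀, hi]
      · simp [hF₀, hji]
    rw [hF, sahiE_update_add, sahiE_update_smul, h1, h2, ih f, ih (update f i (g i)), sum_powerset_insert hi, mul_sum]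
    congr 1
    refine sum_congr rfl fun S hS => ?_
    have hiS : i ∉ S := fun h => hi (mem_powerset.1 hS h)
    rw [prod_insert hiS, mixFam_insert f g hiS, mul_assoc]

/-- **`E_n(1 − a) = Σ_S (−1)^{|S|} E_n(a on S, 1 elsewhere)`** (any weight). [this work] -/
theorem sahiE_one_sub_eq_sum_padded (μ : α → ℝ) {n : ℕ} (a : Fin n → α → ℝ) :
    sahiE μ n (fun j => 1 - a j) = ∑ S ∈ (univ : Finset (Fin n)).powerset,
      (-1 : ℝ) ^ S.card * sahiE μ n (fun j => if j ∈ S then a j else 1) := by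
  have h := sahiE_mix_eq_sum_powerset μ a (fun _ => (-1 : ℝ)) univ (fun _ => 1)
  simp only [mem_univ, if_true, prod_const, neg_one_smul] at h
  have e : (fun j => (1 : α → ℝ) + -a j) = fun j => 1 - a j := by funext j; rw [sub_eq_add_neg]
  rw [e] at h
  rw [h]
  rfl

/-! ### Branching at an arbitrary slot -/

/-- **Branching at slot `i`**: if `F i = 1` and `∑ μ = 1` then `E_{m+2}(F) = m · E_{m+1}(F without slot i)`.
[this work; Sahi's branching rule (tree `sahiE_one_cons`, Sahi 2008 Thm. 6) moved to an arbitrary slot via `sahiE_peel`] -/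
theorem sahiE_eq_mul_of_slot_one {μ : α → ℝ} (hμ : ∑ x, μ x = 1) {m : ℕ} (F : Fin (m + 2) → α → ℝ) (i : Fin (m + 2))
    (hi : F i = 1) : sahiE μ (m + 2) F = m * sahiE μ (m + 1) (fun j => F (i.succAbove j)) := by
  rw [sahiE_peel μ m F i, hi, ex_one hμ, mul_one]
  have h : ∀ l : Fin (m + 1), update (fun j => F (i.succAbove j)) l ((fun j => F (i.succAbove j)) l * 1) =
      fun j => F (i.succAbove j) := fun l => by rw [mul_one, update_eq_self]
  simp only [h, sum_const, card_univ, Fintype.card_fin, nsmul_eq_mul]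
  push_cast
  ring

/-- The same with the arity written `N + 1`, `N ≥ 1`: `E_{N+1}(F) = (N − 1) · E_N(F without slot i)`. [this work] -/
theorem sahiE_eq_mul_of_slot_one' {μ : α → ℝ} (hμ : ∑ x, μ x = 1) {N : ℕ} (hN : 1 ≤ N) (F : Fin (N + 1) → α → ℝ)
    (i : Fin (N + 1)) (hi : F i = 1) : sahiE μ (N + 1) F = ((N : ℝ) - 1) * sahiE μ N (fun j => F (i.succAbove j)) := by
  obtain ⟨m, rfl⟩ : ∃ m, N = m + 1 := ⟨N - 1, by omega⟩
  rw [sahiE_eq_mul_of_slot_one hμ F i hi]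
  push_cast
  ring

/-! ### Iterated branching: families equal to `1` off a set of slots -/

/-- The branching coefficient `∏_{u < t} (s − 1 + u)` (`= (s−2+t)!/(s−2)!` for `s ≥ 2`, `= 0` for `s = 1 ≤ t`). [this work] -/
noncomputable def brCoeff (s t : ℕ) : ℝ := ∏ u ∈ range t, ((s : ℝ) - 1 + u)

/-- Transport of the arity along an equality. [this work] -/
theorem sahiE_cast (μ : α → ℝ) {n n' : ℕ} (h : n = n') (F : Fin n → α → ℝ) :
    sahiE μ n F = sahiE μ n' (fun j => F (Fin.cast h.symm j)) := by
  subst h; rfl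

/-- **Iterated branching**: if `F j = 1` for every slot `j ∉ S` (`|S| = s ≥ 1`), then
`E_n(F) = brCoeff s (n − s) · E_s(F ∘ S.orderEmbOfFin)`. [this work] -/
theorem sahiE_padded_eq {μ : α → ℝ} (hμ : ∑ x, μ x = 1) {s : ℕ} (hs : 1 ≤ s) :
    ∀ (k n : ℕ) (F : Fin n → α → ℝ) (S : Finset (Fin n)) (hS : S.card = s), n - s = k → (∀ j, j ∉ S → F j = 1) →
      sahiE μ n F = brCoeff s k * sahiE μ s (fun j => F (S.orderEmbOfFin hS j)) := by
  intro k
  induction k with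
  | zero =>
    intro n F S hS hk hF
    have hsn : s ≤ n := by rw [← hS]; exact (card_le_univ S).trans (by rw [Fintype.card_fin])
    obtain rfl : s = n := by omega
    have hSu : S = univ := eq_univ_of_card S (by rw [hS, Fintype.card_fin])
    have hid : (fun j : Fin s => j) = fun j => (S.orderEmbOfFin hS j : Fin s) :=
      orderEmbOfFin_unique hS (fun j => hSu ▸ mem_univ j) strictMono_id
    rw [brCoeff, prod_range_zero, one_mul]
    congr 1
    funext j
    exact congrArg F (congrFun hid j)
  | succ k ih =>
    intro n F S hS hk hF
    obtain ⟨N, rfl⟩ : ∃ N, n = N + 1 := ⟨n - 1, by omega⟩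
    have hN : 1 ≤ N := by omega
    -- a slot outside `S`
    have hne : S ≠ univ := fun h => by
      rw [h, card_univ, Fintype.card_fin] at hS; omega
    obtain ⟨i, hiS⟩ : ∃ i, i ∉ S := not_forall.1 fun h => hne (eq_univ_of_forall h)
    rw [sahiE_eq_mul_of_slot_one' hμ hN F i (hF i hiS)]
    -- the deleted family and the pulled-back slot set
    set F' : Fin N → α → ℝ := fun j => F (i.succAbove j) with hF'
    set S' : Finset (Fin N) := S.preimage i.succAbove (Fin.succAbove_right_injective.injOn) with hS'def
    have hS' : S'.card = s := by
      rw [hS'def, card_preimage]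
      rw [← hS]
      congr 1
      ext x
      simp only [mem_filter, and_iff_left_iff_imp]
      intro hx
      exact Fin.exists_succAbove_eq (fun h => hiS (h ▸ hx))
    have hF'1 : ∀ j, j ∉ S' → F' j = 1 := fun j hj => hF _ (fun h => hj (mem_preimage.2 h))
    have hk' : N - s = k := by omega
    rw [ih N F' S' hS' hk' hF'1]
    -- the restrictions agree: `succAbove ∘ orderEmbOfFin S' = orderEmbOfFin S`
    have hemb : (fun j => i.succAbove (S'.orderEmbOfFin hS' j)) = fun j => (S.orderEmbOfFin hS j : Fin (N + 1)) :=
      orderEmbOfFin_unique hS (fun j => mem_preimage.1 (orderEmbOfFin_mem S' hS' j))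
        ((Fin.strictMono_succAbove i).comp (S'.orderEmbOfFin hS').strictMono)
    have hfam : (fun j => F' (S'.orderEmbOfFin hS' j)) = fun j => F (S.orderEmbOfFin hS j) := by
      funext j; exact congrArg F (congrFun hemb j)
    rw [hfam, brCoeff, brCoeff, prod_range_succ, ← mul_assoc]
    congr 1
    have : ((N : ℝ) - 1) = (s : ℝ) - 1 + (k : ℝ) := by
      have h' : N = s + k := by omega
      rw [h']; push_cast; ring
    rw [this, mul_comm]

/-! ### The complement expansion -/

/-- **THE COMPLEMENT EXPANSION (all orders, probability weight).**  For `n ≥ 2` functions `a_0,…,a_{n−1}`: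
`E_n(1 − a) = Σ_{S ⊆ [n], |S| ≥ 1} (−1)^{|S|} · brCoeff |S| (n − |S|) · E_{|S|}(a_S)`, the restriction `a_S = a ∘ S.orderEmbOfFin`;
the coefficient is `(n−2)!/(|S|−2)!` for `|S| ≥ 2` and `0` for `|S| = 1`. [this work] -/
theorem sahiE_one_sub_eq_sum {μ : α → ℝ} (hμ : ∑ x, μ x = 1) {n : ℕ} (hn : 2 ≤ n) (a : Fin n → α → ℝ) :
    sahiE μ n (fun j => 1 - a j) = ∑ S ∈ ((univ : Finset (Fin n)).powerset).filter (fun S => 1 ≤ S.card),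
      (-1 : ℝ) ^ S.card * (brCoeff S.card (n - S.card) * sahiE μ S.card (fun j => a (S.orderEmbOfFin rfl j))) := by
  rw [sahiE_one_sub_eq_sum_padded, sum_filter]
  refine sum_congr rfl fun S _ => ?_
  split_ifs with h
  · rw [sahiE_padded_eq hμ h (n - S.card) n _ S rfl rfl fun j hj => if_neg hj]
    congr 2
    exact congrArg _ (funext fun j => if_pos (orderEmbOfFin_mem S rfl j))
  · have hS : S = ∅ := by
      rw [← card_eq_zero]; omega
    subst hS
    obtain ⟨m, rfl⟩ : ∃ m, n = m + 2 := ⟨n - 2, by omega⟩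
    simp only [notMem_empty, if_false, card_empty, pow_zero, one_mul]
    exact sahiE_const_one hμ m

end SahiComplement

end Summit.CriticalPhenomena.PercolationContinuityZ3.Theorems
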